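import Mathlib
import HarnessLib

/-!
# The resonant power supersolution `η(r) = (rₛ − r)^ν · P(r)` — calculus template for Newcomb's stable
# certificates at a resonant surface

A worked TEMPLATE (pure calculus, no model): at a resonant singular point `rₛ` of a Sturm–Liouville /
Newcomb operator `(f ξ′)′ − g ξ` with `f(r) = (rₛ − r)² φ(r)`, `φ > 0` (a double zero of `f`, Freidberg (11.115);
Newcomb 1960 §7), the comparison function `η(r) = (rₛ − r)^ν P(r)` — `ν` a real exponent (in applications a
RATIONAL strictly between the indicial roots), `P` a `C²` function positive on the piece (a polynomial in
applications) — has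
* `η′ = (rₛ − r)^{ν−1}(−νP + (rₛ − r)P′)` (`hasDerivAt_eta`),
* flux `f η′ = (rₛ − r)^{ν+1} φ (−νP + (rₛ − r)P′)` (`f_mul_deriv_eta`),
* `(f η′)′ = (rₛ − r)^ν · B` with the BRACKET
  `B = ν(ν+1)φP − 2(ν+1)(rₛ − r)φP′ − ν(rₛ − r)φ′P + (rₛ − r)²(φ′P′ + φP″)` (`etaBracket`, `hasDerivAt_flux_eta`),
so that, after division by `(rₛ − r)^ν > 0`, EVERY hypothesis of the tree's supersolution certificates
(`Literature/Analysis/ODE/SingularEndpointSturmComparison.lean` `energy_nonneg_of_twoSupersolutions`;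
`Literature/MathematicalPhysics/MHD/NewcombResonantAlgebraicCertificates.lean`
`fluidEnergyOn_inner_nonneg_of_supersolutions` l.635 / `…middle…` / `stable_oneResonance_of_supersolutions` l.1025:
`hw₂ : ContDiffOn ℝ 1 w₂`, `hw₂pos`, `hODE₂ : HasDerivAt (f · deriv w₂) (q₂ r) r`, `hsuper₂ : q₂ ≤ g w₂`,
`hq₂w : |q₂| ≤ Q₂ w₂`, `hq₂c`) becomes an inequality between `B`, `g·P` and `Q·P` — POLYNOMIAL when `φ, P, g` are
(`super_of_bracket_le`, `abs_flux_le_of_bracket`), decidable by the cell's exact-ℚ / Sturm engines.  At `r = rₛ` the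
bracket is `ν(ν+1)φ(rₛ)P(rₛ)`, so `B ≤ gP` near `rₛ` requires `ν² + ν < g(rₛ)/φ(rₛ)` — `ν` strictly between the
indicial roots `ν± = (−1 ± √(1 + 4g(rₛ)/φ(rₛ)))/2` (real iff Suydam's criterion holds; Freidberg (11.107)).
The mirror template `(r − rₛ)^ν P(r)` for the piece to the RIGHT of `rₛ` is `etaR` (§4).
0 named facts, 0 kit; Mathlib's `Real.rpow` calculus only.

References: W. A. Newcomb, Ann. Phys. 10 (1960) 232, §7; J. P. Freidberg, *Ideal MHD* (2014) §11.5.3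
(11.105)–(11.116) [Freidberg2014]; P. Hartman, *ODE* (2002) Ch. XI §3, §6 [Hartman2002].  The calculus is elementary; the ansatz `x^ν·(series)` at the resonant surface is Freidberg's (11.105).
-/

noncomputable section

open Real Set

namespace Literature.Analysis.ODE.ResonantPower

/-! ### §1 One power step: `d/dr [(rₛ − r)^a H(r)] = (rₛ − r)^{a−1}(−aH + (rₛ − r)H′)` -/

/-- Derivative of `(rₛ − r)^a` for `r < rₛ`. [cite: Freidberg2014, §11.5.3 eqs. (11.105)–(11.107)] -/
theorem hasDerivAt_rpow_sub {rₛ r : ℝ} (a : ℝ) (hr : r < rₛ) :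
    HasDerivAt (fun y => (rₛ - y) ^ a) (-a * (rₛ - r) ^ (a - 1)) r := by
  have hx : rₛ - r ≠ 0 := (sub_pos.2 hr).ne'
  have h1 : HasDerivAt (fun y => rₛ - y) (-1) r := (hasDerivAt_id' r).const_sub rₛ
  have h2 := h1.rpow_const (p := a) (Or.inl hx)
  exact h2.congr_deriv (by ring)

/-- The power step. [cite: Freidberg2014, §11.5.3 eqs. (11.105)–(11.107)] -/
theorem hasDerivAt_rpow_mul {rₛ r a H' : ℝ} {H : ℝ → ℝ} (hr : r < rₛ) (hH : HasDerivAt H H' r) :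
    HasDerivAt (fun y => (rₛ - y) ^ a * H y)
      ((rₛ - r) ^ (a - 1) * (-a * H r + (rₛ - r) * H')) r := by
  have hx : 0 < rₛ - r := sub_pos.2 hr
  have h : HasDerivAt (fun y => (rₛ - y) ^ a * H y) (-a * (rₛ - r) ^ (a - 1) * H r + (rₛ - r) ^ a * H') r :=
    (hasDerivAt_rpow_sub a hr).mul hH
  have e : (rₛ - r) ^ a = (rₛ - r) ^ (a - 1) * (rₛ - r) := by
    rw [Real.rpow_sub_one hx.ne', div_mul_cancel₀ _ hx.ne']
  refine h.congr_deriv ?_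
  rw [e]
  ring

/-! ### §2 The comparison function `η = (rₛ − r)^ν P` and its flux -/

/-- `η(r) = (rₛ − r)^ν · P(r)`. [cite: Freidberg2014, §11.5.3 eq. (11.105)] -/
def eta (rₛ ν : ℝ) (P : ℝ → ℝ) (r : ℝ) : ℝ := (rₛ - r) ^ ν * P r

/-- `η > 0` where `P > 0` (left of `rₛ`). [cite: Freidberg2014, §11.5.3 eqs. (11.105)–(11.107)] -/
theorem eta_pos {rₛ ν r : ℝ} {P : ℝ → ℝ} (hr : r < rₛ) (hP : 0 < P r) : 0 < eta rₛ ν P r :=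
  mul_pos (Real.rpow_pos_of_pos (sub_pos.2 hr) ν) hP

/-- `η′ = (rₛ − r)^{ν−1}(−νP + (rₛ − r)P′)`. [cite: Freidberg2014, §11.5.3 eqs. (11.105)–(11.107)] -/
theorem hasDerivAt_eta {rₛ ν r P'r : ℝ} {P : ℝ → ℝ} (hr : r < rₛ) (hP : HasDerivAt P P'r r) :
    HasDerivAt (eta rₛ ν P) ((rₛ - r) ^ (ν - 1) * (-ν * P r + (rₛ - r) * P'r)) r :=
  hasDerivAt_rpow_mul hr hP

/-- `deriv η`. [cite: Freidberg2014, §11.5.3 eqs. (11.105)–(11.107)] -/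
theorem deriv_eta {rₛ ν r P'r : ℝ} {P : ℝ → ℝ} (hr : r < rₛ) (hP : HasDerivAt P P'r r) :
    deriv (eta rₛ ν P) r = (rₛ - r) ^ (ν - 1) * (-ν * P r + (rₛ - r) * P'r) :=
  (hasDerivAt_eta hr hP).deriv

/-- `η` is `C¹` (indeed `C^n`) to the left of `rₛ` when `P` is. [cite: Freidberg2014, §11.5.3 eqs. (11.105)–(11.107)] -/
theorem contDiffOn_eta {rₛ ν : ℝ} {P : ℝ → ℝ} {S : Set ℝ} {n : ℕ∞} (hS : S ⊆ Iio rₛ)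
    (hP : ContDiffOn ℝ n P S) : ContDiffOn ℝ n (eta rₛ ν P) S := by
  intro x hx
  have hx' : rₛ - x ≠ 0 := (sub_pos.2 (hS hx)).ne'
  have h1 : ContDiffAt ℝ n (fun y : ℝ => (rₛ - y) ^ ν) x :=
    (contDiffAt_const.sub contDiffAt_id).rpow_const_of_ne hx'
  exact h1.contDiffWithinAt.mul (hP x hx)

/-- THE FLUX `f η′` for `f = (rₛ − r)²φ`: `(rₛ − r)^{ν+1} φ (−νP + (rₛ − r)P′)`. [cite: Freidberg2014, §11.5.3 eqs. (11.105)–(11.107)] -/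
def etaFlux (rₛ ν : ℝ) (φ P P' : ℝ → ℝ) (r : ℝ) : ℝ :=
  (rₛ - r) ^ (ν + 1) * (φ r * (-ν * P r + (rₛ - r) * P' r))

/-- `f · η′ = etaFlux` on the piece. [cite: Freidberg2014, §11.5.3 eqs. (11.105)–(11.107)] -/
theorem f_mul_deriv_eta {rₛ ν r : ℝ} {φ P P' : ℝ → ℝ} (hr : r < rₛ) (hP : HasDerivAt P (P' r) r) :
    (rₛ - r) ^ 2 * φ r * deriv (eta rₛ ν P) r = etaFlux rₛ ν φ P P' r := by
  have hx : 0 < rₛ - r := sub_pos.2 hr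
  rw [deriv_eta hr hP, etaFlux]
  have e : (rₛ - r) ^ (ν + 1) = (rₛ - r) ^ (ν - 1) * (rₛ - r) ^ 2 := by
    rw [show ν + 1 = (ν - 1) + 2 by ring, Real.rpow_add hx, Real.rpow_two]
  rw [e]
  ring

/-- THE BRACKET `B = ν(ν+1)φP − 2(ν+1)(rₛ − r)φP′ − ν(rₛ − r)φ′P + (rₛ − r)²(φ′P′ + φP″)`:
`(f η′)′ = (rₛ − r)^ν · B`. [cite: Freidberg2014, §11.5.3 eqs. (11.105)–(11.107)] -/
def etaBracket (rₛ ν : ℝ) (φ φ' P P' P'' : ℝ → ℝ) (r : ℝ) : ℝ :=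
  ν * (ν + 1) * φ r * P r - 2 * (ν + 1) * (rₛ - r) * φ r * P' r - ν * (rₛ - r) * φ' r * P r
    + (rₛ - r) ^ 2 * (φ' r * P' r + φ r * P'' r)

/-- `(f η′)′ = (rₛ − r)^ν · B` (derivative of the flux). [cite: Freidberg2014, §11.5.3 eqs. (11.105)–(11.107)] -/
theorem hasDerivAt_etaFlux {rₛ ν r : ℝ} {φ φ' P P' P'' : ℝ → ℝ} (hr : r < rₛ)
    (hφ : HasDerivAt φ (φ' r) r) (hP : HasDerivAt P (P' r) r) (hP' : HasDerivAt P' (P'' r) r) :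
    HasDerivAt (etaFlux rₛ ν φ P P') ((rₛ - r) ^ ν * etaBracket rₛ ν φ φ' P P' P'' r) r := by
  have hx : 0 < rₛ - r := sub_pos.2 hr
  -- H(y) = φ y * (−ν P y + (rₛ − y) P′ y)
  have hlin : HasDerivAt (fun y => rₛ - y) (-1) r := (hasDerivAt_id' r).const_sub rₛ
  have hH : HasDerivAt (fun y => φ y * (-ν * P y + (rₛ - y) * P' y))
      (φ' r * (-ν * P r + (rₛ - r) * P' r) + φ r * (-ν * P' r + ((-1) * P' r + (rₛ - r) * P'' r))) r :=
    hφ.mul ((hP.const_mul (-ν)).add (hlin.mul hP'))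
  have h := hasDerivAt_rpow_mul (a := ν + 1) hr hH
  have e1 : (fun y => (rₛ - y) ^ (ν + 1) * (φ y * (-ν * P y + (rₛ - y) * P' y))) = etaFlux rₛ ν φ P P' := by
    funext y; rfl
  rw [e1] at h
  refine h.congr_deriv ?_
  rw [show ν + 1 - 1 = ν by ring, etaBracket]
  ring

/-- **THE SUPERSOLUTION DATA IN THE TREE'S FORMAT.**  If `f = (rₛ − r)²φ` on an open set `U ⊆ (−∞, rₛ)` containing
`r`, then `r ↦ f r · deriv η r` has derivative `q(r) := (rₛ − r)^ν B(r)` at `r` — the hypothesis `hODE` of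
`energy_nonneg_of_twoSupersolutions` / `fluidEnergyOn_*_nonneg_of_supersolutions` with `w := η`, `q := (rₛ − ·)^ν B`.
[cite: Hartman2002, Ch. XI §6] -/
theorem hasDerivAt_f_mul_deriv_eta {rₛ ν r : ℝ} {f φ φ' P P' P'' : ℝ → ℝ} {U : Set ℝ} (hU : IsOpen U)
    (hrU : r ∈ U) (hUlt : U ⊆ Iio rₛ) (hf : ∀ y ∈ U, f y = (rₛ - y) ^ 2 * φ y)
    (hPU : ∀ y ∈ U, HasDerivAt P (P' y) y)
    (hφ : HasDerivAt φ (φ' r) r) (hP' : HasDerivAt P' (P'' r) r) :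
    HasDerivAt (fun y => f y * deriv (eta rₛ ν P) y)
      ((rₛ - r) ^ ν * etaBracket rₛ ν φ φ' P P' P'' r) r := by
  have hr : r < rₛ := hUlt hrU
  have h := hasDerivAt_etaFlux (ν := ν) hr hφ (hPU r hrU) hP'
  refine h.congr_of_eventuallyEq ?_
  filter_upwards [hU.mem_nhds hrU] with y hy
  rw [hf y hy, ← f_mul_deriv_eta (hUlt hy) (hPU y hy)]

/-- The comparison flux derivative `q = (rₛ − ·)^ν B` is continuous on any piece left of `rₛ` where `B` is — the
hypothesis `hq₂c` (continuity on the half-open `[r₀, rₛ)`). [cite: Freidberg2014, §11.5.3 eqs. (11.105)–(11.107)] -/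
theorem continuousOn_rpow_mul {rₛ ν : ℝ} {B : ℝ → ℝ} {S : Set ℝ} (hS : S ⊆ Iio rₛ) (hB : ContinuousOn B S) :
    ContinuousOn (fun r => (rₛ - r) ^ ν * B r) S :=
  ((continuousOn_const.sub continuousOn_id).rpow_const fun _ hx => Or.inl (sub_pos.2 (hS hx)).ne').mul hB

/-! ### §3 Dividing the certificate inequalities by `(rₛ − r)^ν > 0` -/

/-- `q ≤ g·η` from the BRACKET inequality `B ≤ g·P`. [cite: Freidberg2014, §11.5.3 eqs. (11.105)–(11.107)] -/
theorem super_of_bracket_le {rₛ ν r : ℝ} {φ φ' P P' P'' g : ℝ → ℝ} (hr : r < rₛ)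
    (hB : etaBracket rₛ ν φ φ' P P' P'' r ≤ g r * P r) :
    (rₛ - r) ^ ν * etaBracket rₛ ν φ φ' P P' P'' r ≤ g r * eta rₛ ν P r := by
  have hx : 0 < (rₛ - r) ^ ν := Real.rpow_pos_of_pos (sub_pos.2 hr) ν
  unfold eta
  nlinarith [mul_le_mul_of_nonneg_left hB hx.le]

/-- `|q| ≤ Q·η` from `|B| ≤ Q·P`. [cite: Freidberg2014, §11.5.3 eqs. (11.105)–(11.107)] -/
theorem abs_flux_le_of_bracket {rₛ ν r Q : ℝ} {φ φ' P P' P'' : ℝ → ℝ} (hr : r < rₛ)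
    (hB : |etaBracket rₛ ν φ φ' P P' P'' r| ≤ Q * P r) :
    |(rₛ - r) ^ ν * etaBracket rₛ ν φ φ' P P' P'' r| ≤ Q * eta rₛ ν P r := by
  have hx : 0 < (rₛ - r) ^ ν := Real.rpow_pos_of_pos (sub_pos.2 hr) ν
  rw [abs_mul, abs_of_pos hx, eta]
  nlinarith [mul_le_mul_of_nonneg_left hB hx.le]

/-- The log-derivative at a matching point: `η′/η = (−νP + (rₛ − r)P′)/((rₛ − r)P)` — a RATIONAL expression, so the
matching hypothesis `hmatch` is an exact-ℚ comparison. [cite: Freidberg2014, §11.5.3 eqs. (11.105)–(11.107)] -/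
theorem deriv_eta_div_eta {rₛ ν r P'r : ℝ} {P : ℝ → ℝ} (hr : r < rₛ) (hP : HasDerivAt P P'r r) (hPr : P r ≠ 0) :
    deriv (eta rₛ ν P) r / eta rₛ ν P r = (-ν * P r + (rₛ - r) * P'r) / ((rₛ - r) * P r) := by
  have hx : 0 < rₛ - r := sub_pos.2 hr
  have hxν : (rₛ - r) ^ ν ≠ 0 := (Real.rpow_pos_of_pos hx ν).ne'
  rw [deriv_eta hr hP, eta]
  have e : (rₛ - r) ^ ν = (rₛ - r) ^ (ν - 1) * (rₛ - r) := by
    rw [Real.rpow_sub_one hx.ne', div_mul_cancel₀ _ hx.ne']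
  rw [e]
  have hx1 : (rₛ - r) ^ (ν - 1) ≠ 0 := (Real.rpow_pos_of_pos hx (ν - 1)).ne'
  field_simp

/-- The bracket AT the resonance: `B(rₛ) = ν(ν+1)φ(rₛ)P(rₛ)`; hence `B < g·P` near `rₛ` needs `ν² + ν < g(rₛ)/φ(rₛ)`,
i.e. `ν` strictly between the indicial roots. [cite: Freidberg2014, §11.5.3 eqs. (11.105)–(11.107)] -/
theorem etaBracket_at_resonance (rₛ ν : ℝ) (φ φ' P P' P'' : ℝ → ℝ) :
    etaBracket rₛ ν φ φ' P P' P'' rₛ = ν * (ν + 1) * φ rₛ * P rₛ := by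
  simp [etaBracket]

/-- Between the indicial roots: if `φ₀ > 0` and `ν² + ν < g₀/φ₀` then `ν(ν+1)φ₀P₀ < g₀P₀` for `P₀ > 0` — the strict
bracket inequality at `rₛ` (continuity then gives a neighbourhood; the instance certifies the whole piece by
Sturm / interval arithmetic). [cite: Freidberg2014, §11.5.3 eq. (11.107)] -/
theorem bracket_lt_at_resonance {ν φ₀ g₀ P₀ : ℝ} (hφ : 0 < φ₀) (hP : 0 < P₀) (hν : ν ^ 2 + ν < g₀ / φ₀) :
    ν * (ν + 1) * φ₀ * P₀ < g₀ * P₀ := by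
  have h1 : (ν ^ 2 + ν) * φ₀ < g₀ := by
    have := mul_lt_mul_of_pos_right hν hφ
    rwa [div_mul_cancel₀ _ hφ.ne'] at this
  nlinarith

/-! ### §4 The mirror template to the RIGHT of `rₛ`: `ηR = (r − rₛ)^ν P` -/

/-- `ηR(r) = (r − rₛ)^ν · P(r)`. [cite: Freidberg2014, §11.5.3 eq. (11.105)] -/
def etaR (rₛ ν : ℝ) (P : ℝ → ℝ) (r : ℝ) : ℝ := (r - rₛ) ^ ν * P r

/-- `ηR > 0` where `P > 0` (right of `rₛ`). [cite: Freidberg2014, §11.5.3 eqs. (11.105)–(11.107)] -/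
theorem etaR_pos {rₛ ν r : ℝ} {P : ℝ → ℝ} (hr : rₛ < r) (hP : 0 < P r) : 0 < etaR rₛ ν P r :=
  mul_pos (Real.rpow_pos_of_pos (sub_pos.2 hr) ν) hP

/-- Derivative of `(r − rₛ)^a` for `rₛ < r`. [cite: Freidberg2014, §11.5.3 eqs. (11.105)–(11.107)] -/
theorem hasDerivAt_rpow_subR {rₛ r : ℝ} (a : ℝ) (hr : rₛ < r) :
    HasDerivAt (fun y => (y - rₛ) ^ a) (a * (r - rₛ) ^ (a - 1)) r := by
  have hx : r - rₛ ≠ 0 := (sub_pos.2 hr).ne'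
  have h1 : HasDerivAt (fun y => y - rₛ) 1 r := (hasDerivAt_id' r).sub_const rₛ
  have h2 := h1.rpow_const (p := a) (Or.inl hx)
  exact h2.congr_deriv (by ring)

/-- The power step to the right. [cite: Freidberg2014, §11.5.3 eqs. (11.105)–(11.107)] -/
theorem hasDerivAt_rpow_mulR {rₛ r a H' : ℝ} {H : ℝ → ℝ} (hr : rₛ < r) (hH : HasDerivAt H H' r) :
    HasDerivAt (fun y => (y - rₛ) ^ a * H y)
      ((r - rₛ) ^ (a - 1) * (a * H r + (r - rₛ) * H')) r := by
  have hx : 0 < r - rₛ := sub_pos.2 hr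
  have h : HasDerivAt (fun y => (y - rₛ) ^ a * H y) (a * (r - rₛ) ^ (a - 1) * H r + (r - rₛ) ^ a * H') r :=
    (hasDerivAt_rpow_subR a hr).mul hH
  have e : (r - rₛ) ^ a = (r - rₛ) ^ (a - 1) * (r - rₛ) := by
    rw [Real.rpow_sub_one hx.ne', div_mul_cancel₀ _ hx.ne']
  refine h.congr_deriv ?_
  rw [e]
  ring

/-- `ηR′ = (r − rₛ)^{ν−1}(νP + (r − rₛ)P′)`. [cite: Freidberg2014, §11.5.3 eqs. (11.105)–(11.107)] -/
theorem hasDerivAt_etaR {rₛ ν r P'r : ℝ} {P : ℝ → ℝ} (hr : rₛ < r) (hP : HasDerivAt P P'r r) :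
    HasDerivAt (etaR rₛ ν P) ((r - rₛ) ^ (ν - 1) * (ν * P r + (r - rₛ) * P'r)) r :=
  hasDerivAt_rpow_mulR hr hP

/-- `deriv ηR`. [cite: Freidberg2014, §11.5.3 eqs. (11.105)–(11.107)] -/
theorem deriv_etaR {rₛ ν r P'r : ℝ} {P : ℝ → ℝ} (hr : rₛ < r) (hP : HasDerivAt P P'r r) :
    deriv (etaR rₛ ν P) r = (r - rₛ) ^ (ν - 1) * (ν * P r + (r - rₛ) * P'r) :=
  (hasDerivAt_etaR hr hP).deriv

/-- `ηR` is `C^n` to the right of `rₛ` when `P` is. [cite: Freidberg2014, §11.5.3 eqs. (11.105)–(11.107)] -/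
theorem contDiffOn_etaR {rₛ ν : ℝ} {P : ℝ → ℝ} {S : Set ℝ} {n : ℕ∞} (hS : S ⊆ Ioi rₛ)
    (hP : ContDiffOn ℝ n P S) : ContDiffOn ℝ n (etaR rₛ ν P) S := by
  intro x hx
  have hx' : x - rₛ ≠ 0 := (sub_pos.2 (hS hx)).ne'
  have h1 : ContDiffAt ℝ n (fun y : ℝ => (y - rₛ) ^ ν) x :=
    (contDiffAt_id.sub contDiffAt_const).rpow_const_of_ne hx'
  exact h1.contDiffWithinAt.mul (hP x hx)

/-- The flux to the right: `f ηR′ = (r − rₛ)^{ν+1} φ (νP + (r − rₛ)P′)` for `f = (r − rₛ)²φ`. [cite: Freidberg2014, §11.5.3 eqs. (11.105)–(11.107)] -/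
def etaFluxR (rₛ ν : ℝ) (φ P P' : ℝ → ℝ) (r : ℝ) : ℝ :=
  (r - rₛ) ^ (ν + 1) * (φ r * (ν * P r + (r - rₛ) * P' r))

/-- `f · ηR′ = etaFluxR`. [cite: Freidberg2014, §11.5.3 eqs. (11.105)–(11.107)] -/
theorem f_mul_deriv_etaR {rₛ ν r : ℝ} {φ P P' : ℝ → ℝ} (hr : rₛ < r) (hP : HasDerivAt P (P' r) r) :
    (r - rₛ) ^ 2 * φ r * deriv (etaR rₛ ν P) r = etaFluxR rₛ ν φ P P' r := by
  have hx : 0 < r - rₛ := sub_pos.2 hr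
  rw [deriv_etaR hr hP, etaFluxR]
  have e : (r - rₛ) ^ (ν + 1) = (r - rₛ) ^ (ν - 1) * (r - rₛ) ^ 2 := by
    rw [show ν + 1 = (ν - 1) + 2 by ring, Real.rpow_add hx, Real.rpow_two]
  rw [e]
  ring

/-- The bracket to the right: `BR = ν(ν+1)φP + 2(ν+1)(r − rₛ)φP′ + ν(r − rₛ)φ′P + (r − rₛ)²(φ′P′ + φP″)`. [cite: Freidberg2014, §11.5.3 eqs. (11.105)–(11.107)] -/
def etaBracketR (rₛ ν : ℝ) (φ φ' P P' P'' : ℝ → ℝ) (r : ℝ) : ℝ :=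
  ν * (ν + 1) * φ r * P r + 2 * (ν + 1) * (r - rₛ) * φ r * P' r + ν * (r - rₛ) * φ' r * P r
    + (r - rₛ) ^ 2 * (φ' r * P' r + φ r * P'' r)

/-- `(f ηR′)′ = (r − rₛ)^ν · BR`. [cite: Freidberg2014, §11.5.3 eqs. (11.105)–(11.107)] -/
theorem hasDerivAt_etaFluxR {rₛ ν r : ℝ} {φ φ' P P' P'' : ℝ → ℝ} (hr : rₛ < r)
    (hφ : HasDerivAt φ (φ' r) r) (hP : HasDerivAt P (P' r) r) (hP' : HasDerivAt P' (P'' r) r) :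
    HasDerivAt (etaFluxR rₛ ν φ P P') ((r - rₛ) ^ ν * etaBracketR rₛ ν φ φ' P P' P'' r) r := by
  have hlin : HasDerivAt (fun y => y - rₛ) 1 r := (hasDerivAt_id' r).sub_const rₛ
  have hH : HasDerivAt (fun y => φ y * (ν * P y + (y - rₛ) * P' y))
      (φ' r * (ν * P r + (r - rₛ) * P' r) + φ r * (ν * P' r + (1 * P' r + (r - rₛ) * P'' r))) r :=
    hφ.mul ((hP.const_mul ν).add (hlin.mul hP'))
  have h := hasDerivAt_rpow_mulR (a := ν + 1) hr hH
  have e1 : (fun y => (y - rₛ) ^ (ν + 1) * (φ y * (ν * P y + (y - rₛ) * P' y))) = etaFluxR rₛ ν φ P P' := by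
    funext y; rfl
  rw [e1] at h
  refine h.congr_deriv ?_
  rw [show ν + 1 - 1 = ν by ring, etaBracketR]
  ring

/-- The supersolution data to the right in the tree's format. [cite: Hartman2002, Ch. XI §6] -/
theorem hasDerivAt_f_mul_deriv_etaR {rₛ ν r : ℝ} {f φ φ' P P' P'' : ℝ → ℝ} {U : Set ℝ} (hU : IsOpen U)
    (hrU : r ∈ U) (hUgt : U ⊆ Ioi rₛ) (hf : ∀ y ∈ U, f y = (y - rₛ) ^ 2 * φ y)
    (hPU : ∀ y ∈ U, HasDerivAt P (P' y) y)
    (hφ : HasDerivAt φ (φ' r) r) (hP' : HasDerivAt P' (P'' r) r) :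
    HasDerivAt (fun y => f y * deriv (etaR rₛ ν P) y)
      ((r - rₛ) ^ ν * etaBracketR rₛ ν φ φ' P P' P'' r) r := by
  have hr : rₛ < r := hUgt hrU
  have h := hasDerivAt_etaFluxR (ν := ν) hr hφ (hPU r hrU) hP'
  refine h.congr_of_eventuallyEq ?_
  filter_upwards [hU.mem_nhds hrU] with y hy
  rw [hf y hy, ← f_mul_deriv_etaR (hUgt hy) (hPU y hy)]

/-- `q ≤ g·ηR` from `BR ≤ g·P` (right piece). [cite: Freidberg2014, §11.5.3 eqs. (11.105)–(11.107)] -/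
theorem superR_of_bracket_le {rₛ ν r : ℝ} {φ φ' P P' P'' g : ℝ → ℝ} (hr : rₛ < r)
    (hB : etaBracketR rₛ ν φ φ' P P' P'' r ≤ g r * P r) :
    (r - rₛ) ^ ν * etaBracketR rₛ ν φ φ' P P' P'' r ≤ g r * etaR rₛ ν P r := by
  have hx : 0 < (r - rₛ) ^ ν := Real.rpow_pos_of_pos (sub_pos.2 hr) ν
  unfold etaR
  nlinarith [mul_le_mul_of_nonneg_left hB hx.le]

/-- `|q| ≤ Q·ηR` from `|BR| ≤ Q·P` (right piece). [cite: Freidberg2014, §11.5.3 eqs. (11.105)–(11.107)] -/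
theorem abs_fluxR_le_of_bracket {rₛ ν r Q : ℝ} {φ φ' P P' P'' : ℝ → ℝ} (hr : rₛ < r)
    (hB : |etaBracketR rₛ ν φ φ' P P' P'' r| ≤ Q * P r) :
    |(r - rₛ) ^ ν * etaBracketR rₛ ν φ φ' P P' P'' r| ≤ Q * etaR rₛ ν P r := by
  have hx : 0 < (r - rₛ) ^ ν := Real.rpow_pos_of_pos (sub_pos.2 hr) ν
  rw [abs_mul, abs_of_pos hx, etaR]
  nlinarith [mul_le_mul_of_nonneg_left hB hx.le]

/-- Log-derivative of `ηR` at a matching point (rational in the data). [cite: Freidberg2014, §11.5.3 eqs. (11.105)–(11.107)] -/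
theorem deriv_etaR_div_etaR {rₛ ν r P'r : ℝ} {P : ℝ → ℝ} (hr : rₛ < r) (hP : HasDerivAt P P'r r)
    (hPr : P r ≠ 0) :
    deriv (etaR rₛ ν P) r / etaR rₛ ν P r = (ν * P r + (r - rₛ) * P'r) / ((r - rₛ) * P r) := by
  have hx : 0 < r - rₛ := sub_pos.2 hr
  rw [deriv_etaR hr hP, etaR]
  have e : (r - rₛ) ^ ν = (r - rₛ) ^ (ν - 1) * (r - rₛ) := by
    rw [Real.rpow_sub_one hx.ne', div_mul_cancel₀ _ hx.ne']
  rw [e]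
  have hx1 : (r - rₛ) ^ (ν - 1) ≠ 0 := (Real.rpow_pos_of_pos hx (ν - 1)).ne'
  field_simp

/-- Continuity of `q = (· − rₛ)^ν BR` on a piece right of `rₛ`. [cite: Freidberg2014, §11.5.3 eqs. (11.105)–(11.107)] -/
theorem continuousOn_rpow_mulR {rₛ ν : ℝ} {B : ℝ → ℝ} {S : Set ℝ} (hS : S ⊆ Ioi rₛ) (hB : ContinuousOn B S) :
    ContinuousOn (fun r => (r - rₛ) ^ ν * B r) S :=
  ((continuousOn_id.sub continuousOn_const).rpow_const fun _ hx => Or.inl (sub_pos.2 (hS hx)).ne').mul hB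

end Literature.Analysis.ODE.ResonantPower

end
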